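import Literature.Probability.LatticeModels.RandomClusterSuccessiveConditioning
import Literature.Probability.LatticeModels.RandomClusterConditionalDomination
import Literature.Probability.LatticeModels.RandomClusterEmbedding
import Literature.Probability.LatticeModels.CriticalFKIsingArmVanishes
import Literature.Probability.LatticeModels.CriticalFKIsingConnectionLawsBox
import HarnessLib

/-!
# Increasing events of pairwise disjoint sub-pieces: the wired product bound, proved

Topic `Literature/Probability/LatticeModels` (trunk `StatMech`, family `crit-ising`). For the wired
random-cluster measure `φ¹_Δ = rcMeasure (finsetGraph G Δ) p q (wiredBoundary G Δ)` of a finite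
piece `Δ` of a locally finite graph `G` (`0 ≤ p ≤ 1`, `q ≥ 1`) and sub-pieces `Λ ⊆ Δ`:

* `rcMeasure_real_restrict_inter_cylinder_le` — **the conditional form of the monotonicity in the
  domain** (Grimmett 2006, Lemma (4.13) with Lemma (4.14)(b): given ANY configuration `ξ` of the
  edges of `Δ` off `E_Λ`, the conditional law of `ω ∩ E_Λ` is the random-cluster measure of `Λ`
  with the boundary condition induced by `ξ`, which is dominated by the wired one): for every
  increasing event `A` of `E_Λ`,
  `φ¹_Δ({ω ∩ E_Λ ∈ ρ⁻¹A} ∩ {ω ∖ E_Λ = ξ}) ≤ φ¹_Λ(A) · φ¹_Δ({ω ∖ E_Λ = ξ})`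
  (`ρ` = restriction to `E_Λ`). Proof: the tree's conditional domination
  `rcMeasure_real_inter_cylinder_le_mul_fromEdgeSet` (Holley) with the wired set "`∂Λ` and every
  vertex off `Λ`", which contains `∂Δ` and both endpoints of every edge off `E_Λ`, followed by the
  identification of the spanning graph `⟨E_Λ⟩` of `Δ`, idle vertices wired, with `Λ`
  (`rcMeasure_real_restrictConfig_preimage_of_wired`).
* `rcMeasure_real_iInter_restrict_le_prod` — **increasing events of pairwise disjoint sub-pieces
  multiply under the wired bound**: for pairwise disjoint `Λ_i ⊆ Δ` and increasing events `A_i` of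
  `E_{Λ_i}`, `φ¹_Δ(⋂_i {ω ∩ E_{Λ_i} ∈ ρ_i⁻¹ A_i}) ≤ ∏_i φ¹_{Λ_i}(A_i)` (successive conditioning,
  `rcMeasure_real_biInter_le_prod`, fed with the first item).
* `rcMeasure_real_siteArms_le_thetaWiredBox_pow` — on `ℤ^d`: if the sup-boxes `x_i + Λ_N` are
  pairwise disjoint and lie in `Λ_L`, the `φ¹_{Λ_L}`-probability that every `x_i` is joined by an
  open path to a point outside `x_i + Λ_N` is at most `(φ¹_{Λ_N}(0 ↔ ∂Λ_N))^{#ι}`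
  (`thetaWiredBox`; each arm crosses its own box, Grimmett 2006, proof of Prop. (5.11), and the
  boxes are translates of `Λ_N`, §4.3).

Everything is proved; no definitions. Used by the route `CriticalPhenomena/Ising3DConformalLimit/ArmDressing`
(crux `EvenPatternDecoupling`: the joint point-arm probability is at most `θ¹_{⌊a/δ⌋}^n`).

## References

* G. Grimmett, *The Random-Cluster Model*, Springer (2006): §4.2 Lemma (4.13) (domain Markov /
  nesting), Lemma (4.14)(b) (comparison of boundary conditions), Thm. (4.19)(a) proof eq. (4.24),
  §4.3 (translation invariance), Prop. (5.11) (proof). [Grimmett2006]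
* H. Duminil-Copin, S. Smirnov, *Conformal invariance of lattice models*, Clay Math. Proc. 15
  (2012), §6.1, proof of Thm. 6.1 (successive conditioning). [DuminilCopinSmirnov2012Clay]
-/

noncomputable section

namespace Literature.Probability.LatticeModels

open MeasureTheory Finset SimpleGraph
open Literature.Probability.Percolation Literature.Barriers.CriticalPhenomena

/-! ### One sub-piece: the conditional wired bound -/

section SubPiece

variable {V : Type*} [DecidableEq V] {G : SimpleGraph V} [DecidableRel G.Adj] [G.LocallyFinite]
  {Λ Δ : Finset V} (h : Λ ⊆ Δ)

omit [DecidableEq V] [G.LocallyFinite] in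
/-- On configurations of the edges of `Δ`, restricting the part on `E_Λ` is restricting.
[folklore] -/
theorem finsetRestrict_inter_insideEdges {ω : BondConfig Δ} (hω : ω ⊆ (finsetGraph G Δ).edgeSet) :
    finsetRestrict h (ω ∩ ↑(insideEdges G h)) = finsetRestrict h ω := by
  ext e
  simp only [mem_finsetRestrict_iff, Set.mem_inter_iff, Finset.mem_coe,
    edgeLift_mem_insideEdges_iff]
  refine ⟨fun h' => h'.1, fun he => ⟨he, ?_⟩⟩
  exact (edgeLift_mem_edgeFinset_iff h e).1 (mem_edgeFinset.2 (hω he))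

omit [DecidableEq V] [G.LocallyFinite] in
/-- Every vertex of an inner edge lies in `Λ`. [folklore] -/
theorem coe_mem_of_mem_insideEdges {e : Sym2 Δ} (he : e ∈ insideEdges G h) {u : Δ} (hu : u ∈ e) :
    u.1 ∈ Λ := by
  obtain ⟨e', -, rfl⟩ := Finset.mem_map.1 he
  obtain ⟨a, -, rfl⟩ := Sym2.mem_map.1 hu
  exact a.2

/-- **Conditional monotonicity in the domain, wired boundary** (Grimmett 2006, Lemma (4.13) with
Lemma (4.14)(b)): for `Λ ⊆ Δ` with `∂Λ ≠ ∅`, `0 ≤ p ≤ 1`, `q ≥ 1`, an increasing event `A` of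
`E_Λ` and every configuration `ξ` of the edges of `Δ` off `E_Λ`,
`φ¹_Δ({ω ∩ E_Λ ∈ ρ⁻¹A} ∩ {ω ∖ E_Λ = ξ}) ≤ φ¹_Λ(A) · φ¹_Δ({ω ∖ E_Λ = ξ})`: whatever the
configuration outside, the conditional probability of an increasing event of the sub-piece is at
most its wired probability. [cite: Grimmett2006, Lemma (4.13) and Lemma (4.14)(b)] -/
theorem rcMeasure_real_restrict_inter_cylinder_le (hne : (innerBoundary G Λ).Nonempty)
    {p q : ℝ} (hp : p ∈ Set.Icc (0 : ℝ) 1) (hq : 1 ≤ q)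
    {A : Set (BondConfig Λ)} (hA : IsUpperSet A)
    {ξ : Set (Sym2 Δ)} (hξ : ξ ⊆ (finsetGraph G Δ).edgeSet \ ↑(insideEdges G h)) :
    (rcMeasure (finsetGraph G Δ) p q (wiredBoundary G Δ)).real
        ({ω | ω ∩ ↑(insideEdges G h) ∈ finsetRestrict h ⁻¹' A} ∩
          {ω | ω ∩ (↑(insideEdges G h) : Set (Sym2 Δ))ᶜ = ξ}) ≤
      (rcMeasure (finsetGraph G Λ) p q (wiredBoundary G Λ)).real A *
        (rcMeasure (finsetGraph G Δ) p q (wiredBoundary G Δ)).real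
          {ω | ω ∩ (↑(insideEdges G h) : Set (Sym2 Δ))ᶜ = ξ} := by
  classical
  have hq0 : 0 < q := one_pos.trans_le hq
  set j : Λ ↪ Δ := finsetInclEmb h with hjdef
  have hj : ∀ x : Λ, (j x).1 = x.1 := fun x => rfl
  have hUE : insideEdges G h ⊆ (finsetGraph G Δ).edgeFinset := insideEdges_subset_edgeFinset h
  -- the wired set of the comparison measure: `∂Λ` and every vertex of `Δ` off `Λ`
  set W : Set Δ := {u | ∀ x : Λ, j x = u → x ∈ wiredBoundary G Λ} with hWdef
  have hBW : wiredBoundary G Δ ⊆ W := by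
    intro u hu x hxu
    rw [mem_wiredBoundary_iff, mem_innerBoundary_iff] at hu ⊢
    obtain ⟨-, y, hy, huy⟩ := hu
    refine ⟨x.2, y, fun hyΛ => hy (h hyΛ), ?_⟩
    rw [← hxu, hj] at huy
    exact huy
  have hξW : ∀ e ∈ ξ, ∀ u ∈ e, u ∈ W := by
    intro e he u hu x hxu
    obtain ⟨heE, heU⟩ := hξ he
    have heq : s(u, Sym2.Mem.other hu) = e := Sym2.other_spec hu
    rw [← heq] at heE heU
    have h1 : finsetIncl h x = u := hxu
    have hu1 : u.1 = x.1 := by rw [← h1]; rfl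
    have hadj : G.Adj x.1 (Sym2.Mem.other hu).1 := by
      rw [mem_edgeSet] at heE
      rw [← hu1]
      exact heE
    rw [mem_wiredBoundary_iff, mem_innerBoundary_iff]
    refine ⟨x.2, (Sym2.Mem.other hu).1, fun hvΛ => heU ?_, hadj⟩
    have h2 : finsetIncl h ⟨(Sym2.Mem.other hu).1, hvΛ⟩ = Sym2.Mem.other hu := Subtype.ext rfl
    have h3 : edgeLift h s(x, ⟨(Sym2.Mem.other hu).1, hvΛ⟩) = s(u, Sym2.Mem.other hu) := by
      rw [edgeLift_mk, h1, h2]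
    rw [Finset.mem_coe, ← h3, edgeLift_mem_insideEdges_iff, mem_edgeFinset, mem_edgeSet]
    exact hadj
  have hA' : IsUpperSet (finsetRestrict h ⁻¹' A) := fun ω₁ ω₂ hle h₁ =>
    hA (finsetRestrict_mono h hle) h₁
  -- conditional domination by the spanning graph `⟨E_Λ⟩` of `Δ` wired on `W`
  have key := rcMeasure_real_inter_cylinder_le_mul_fromEdgeSet (finsetGraph G Δ) hp hq
    (wiredBoundary G Δ) (insideEdges G h) hUE ξ hBW hξW hA'
  -- which is the wired measure of `Λ`
  have hE : ∀ i : Fintype (fromEdgeSet (↑(insideEdges G h) : Set (Sym2 Δ))).edgeSet,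
      @SimpleGraph.edgeFinset _ (fromEdgeSet (↑(insideEdges G h) : Set (Sym2 Δ))) i =
        (finsetGraph G Λ).edgeFinset.map j.sym2Map := fun i => by
    rw [@edgeFinset_fromEdgeSet_of_subset _ _ (finsetGraph G Δ) _ (insideEdges G h) hUE i]
    rfl
  have hWne : (wiredBoundary G Λ).Nonempty := by
    obtain ⟨x, hx⟩ := hne
    exact ⟨⟨x, (mem_innerBoundary_iff.1 hx).1⟩, hx⟩
  have hid := rcMeasure_real_restrictConfig_preimage_of_wired j (hE _) hp hq0 hWne
    (W' := W) (fun u => Iff.rfl) A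
  have hid' : (rcMeasure (fromEdgeSet (↑(insideEdges G h) : Set (Sym2 Δ))) p q W).real
      (finsetRestrict h ⁻¹' A) = (rcMeasure (finsetGraph G Λ) p q (wiredBoundary G Λ)).real A :=
    hid
  calc _ ≤ _ := key
    _ = _ := by rw [hid', mul_comm]

end SubPiece

/-! ### Pairwise disjoint sub-pieces: the product bound -/

section Product

variable {V : Type*} [DecidableEq V] {G : SimpleGraph V} [DecidableRel G.Adj] [G.LocallyFinite]
  {Δ : Finset V}

/-- **Increasing events of pairwise disjoint sub-pieces multiply under the wired bound**
(successive conditioning, Duminil-Copin–Smirnov 2012, §6.1; domain Markov property with the wired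
boundary condition maximal, Grimmett 2006, Lemma (4.13)–(4.14)): for pairwise disjoint
`Λ_i ⊆ Δ` with `∂Λ_i ≠ ∅` and increasing events `A_i` of `E_{Λ_i}`,
`φ¹_Δ(⋂_i {ω ∩ E_{Λ_i} ∈ ρ_i⁻¹ A_i}) ≤ ∏_i φ¹_{Λ_i}(A_i)` (`0 ≤ p ≤ 1`, `q ≥ 1`).
[cite: Grimmett2006, Lemma (4.13) and Lemma (4.14)(b)]
[cite: DuminilCopinSmirnov2012Clay, §6.1, proof of Thm. 6.1, eq. (6.2)] -/
theorem rcMeasure_real_iInter_restrict_le_prod {p q : ℝ} (hp : p ∈ Set.Icc (0 : ℝ) 1)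
    (hq : 1 ≤ q) {ι : Type*} [Fintype ι] (Λ : ι → Finset V) (hΛ : ∀ i, Λ i ⊆ Δ)
    (hdisj : Pairwise fun i j => Disjoint (Λ i) (Λ j))
    (hne : ∀ i, (innerBoundary G (Λ i)).Nonempty)
    (A : ∀ i, Set (BondConfig ↥(Λ i))) (hA : ∀ i, IsUpperSet (A i)) :
    (rcMeasure (finsetGraph G Δ) p q (wiredBoundary G Δ)).real
        (⋂ i, {ω | ω ∩ ↑(insideEdges G (hΛ i)) ∈ finsetRestrict (hΛ i) ⁻¹' A i}) ≤
      ∏ i, (rcMeasure (finsetGraph G (Λ i)) p q (wiredBoundary G (Λ i))).real (A i) := by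
  classical
  have hq0 : 0 < q := one_pos.trans_le hq
  have h1 := rcMeasure_real_biInter_le_prod (finsetGraph G Δ) hp hq0 (wiredBoundary G Δ)
    Finset.univ (fun i => insideEdges G (hΛ i)) ?_
    (fun i => {ω | ω ∩ ↑(insideEdges G (hΛ i)) ∈ finsetRestrict (hΛ i) ⁻¹' A i}) ?_
    (fun i => (rcMeasure (finsetGraph G (Λ i)) p q (wiredBoundary G (Λ i))).real (A i))
    (fun i _ => measureReal_nonneg) ?_
  · simpa only [Finset.mem_univ, Set.iInter_true] using h1
  · -- the inner edge sets of disjoint sub-pieces are disjoint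
    intro i _ i' _ hii'
    rw [Finset.disjoint_left]
    intro e hei hei'
    obtain ⟨u, hu⟩ : ∃ u, u ∈ e := ⟨_, Sym2.out_fst_mem e⟩
    exact Finset.disjoint_left.1 (hdisj hii') (coe_mem_of_mem_insideEdges (hΛ i) hei hu)
      (coe_mem_of_mem_insideEdges (hΛ i') hei' hu)
  · -- each event is determined by the configuration on its region
    intro i _ ω₁ ω₂ hω
    simp only [Set.mem_setOf_eq]
    rw [hω]
  · -- the conditional wired bound, uniformly in the configuration off the region
    intro i _ ξ hξ
    refine rcMeasure_real_restrict_inter_cylinder_le (hΛ i) (hne i) hp hq (hA i) fun e he => ?_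
    have he' := hξ (Finset.mem_coe.1 he)
    rw [Finset.mem_sdiff, mem_edgeFinset] at he'
    exact ⟨he'.1, fun h' => he'.2 (Finset.mem_coe.1 h')⟩

end Product

/-! ### Boxes of `ℤ^d`: simultaneous arms out of disjoint sup-boxes -/

section Zd

variable {d : ℕ}

/-- **Simultaneous arms out of pairwise disjoint boxes cost the product of the wired one-arm
probabilities** (Grimmett 2006, proof of Prop. (5.11): an open path from `x_i` to a point outside
`x_i + Λ_N` crosses `∂(x_i + Λ_N)` inside the box, an increasing event of the box; domain Markov
with the wired boundary condition maximal, iterated over the disjoint boxes; translation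
invariance, §4.3): if the boxes `x_i + Λ_N = ∏ₖ [-N + x_i k, N + x_i k] ⊆ Λ_L` are pairwise
disjoint, then the `φ¹_{Λ_L,p,q}`-probability that every `x_i` is joined by an open path of `Λ_L`
to a vertex outside `x_i + Λ_N` is at most `(φ¹_{Λ_N,p,q}(0 ↔ ∂Λ_N))^{#ι}` (`d ≥ 1`,
`0 ≤ p ≤ 1`, `q ≥ 1`). [cite: Grimmett2006, Prop. (5.11) (proof), Lemma (4.13) and Lemma (4.14)(b)] -/
theorem rcMeasure_real_siteArms_le_thetaWiredBox_pow (hd : 0 < d) {p q : ℝ}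
    (hp : p ∈ Set.Icc (0 : ℝ) 1) (hq : 1 ≤ q) {ι : Type*} [Fintype ι] (x : ι → Site d) (N L : ℕ)
    (hsub : ∀ i, Finset.Icc (fun k => -(N : ℤ) + x i k) (fun k => (N : ℤ) + x i k) ⊆ box d L)
    (hdisj : Pairwise fun i j => Disjoint (Finset.Icc (fun k => -(N : ℤ) + x i k) (fun k => (N : ℤ) + x i k))
      (Finset.Icc (fun k => -(N : ℤ) + x j k) (fun k => (N : ℤ) + x j k))) :
    (rcMeasure (boxGraph d L) p q (boxBoundary d L)).real
        {ω | ∀ i, ∃ a b : BoxV d L, a.1 = x i ∧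
          b.1 ∉ Finset.Icc (fun k => -(N : ℤ) + x i k) (fun k => (N : ℤ) + x i k) ∧
            (openGraph ω).Reachable a b} ≤
      thetaWiredBox d p q N ^ Fintype.card ι := by
  classical
  have hq0 : 0 < q := one_pos.trans_le hq
  -- the sub-boxes and their arm events
  set Λ : ι → Finset (Site d) := fun i =>
    Finset.Icc (fun k => -(N : ℤ) + x i k) (fun k => (N : ℤ) + x i k) with hΛdef
  set A : ∀ i, Set (BondConfig ↥(Λ i)) := fun i =>
    {η | ∃ a y : ↥(Λ i), a.1 = x i ∧ y ∈ wiredBoundary (zdGraph d) (Λ i) ∧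
      (openGraph η).Reachable a y} with hAdef
  have hA : ∀ i, IsUpperSet (A i) := fun i => isUpperSet_siteArmEvent _ (x i)
  have hne : ∀ i, (innerBoundary (zdGraph d) (Λ i)).Nonempty := fun i =>
    innerBoundary_Icc_nonempty hd fun k => by
      show -(N : ℤ) + x i k ≤ (N : ℤ) + x i k
      omega
  have h2 := rcMeasure_real_iInter_restrict_le_prod (G := zdGraph d) (Δ := box d L) hp hq Λ hsub
    hdisj hne A hA
  calc (rcMeasure (boxGraph d L) p q (boxBoundary d L)).real
        {ω | ∀ i, ∃ a b : BoxV d L, a.1 = x i ∧ b.1 ∉ Λ i ∧ (openGraph ω).Reachable a b}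
      ≤ (rcMeasure (finsetGraph (zdGraph d) (box d L)) p q (wiredBoundary (zdGraph d) (box d L))).real
          (⋂ i, {ω | ω ∩ ↑(insideEdges (zdGraph d) (hsub i)) ∈
            finsetRestrict (hsub i) ⁻¹' A i}) := by
        refine rcMeasure_real_mono_on_edgeSets _ hp hq0 _ (fun ω hω hmem => ?_)
        rw [Set.mem_iInter]
        intro i
        obtain ⟨a, b, ha, hb, hab⟩ := hmem i
        show finsetRestrict (hsub i) (ω ∩ ↑(insideEdges (zdGraph d) (hsub i))) ∈ A i
        rw [finsetRestrict_inter_insideEdges (hsub i) hω]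
        have hxmem : x i ∈ Λ i := centre_mem_icc_shift (x i) N
        have ha' : a = finsetIncl (hsub i) ⟨x i, hxmem⟩ := Subtype.ext ha
        rw [ha'] at hab
        obtain ⟨z, hz, hxz⟩ := exists_reachable_wiredBoundary_restrict_of_notMem (hsub i) hω hb hab
        exact ⟨⟨x i, hxmem⟩, z, rfl, hz, hxz⟩
    _ ≤ ∏ i, (rcMeasure (finsetGraph (zdGraph d) (Λ i)) p q
          (wiredBoundary (zdGraph d) (Λ i))).real (A i) := h2
    _ ≤ ∏ _i : ι, thetaWiredBox d p q N :=
        Finset.prod_le_prod (fun i _ => measureReal_nonneg) fun i _ =>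
          rcMeasure_real_siteArm_icc_shift_le_thetaWiredBox hp hq0 (x i) N
    _ = thetaWiredBox d p q N ^ Fintype.card ι := by rw [Finset.prod_const, Finset.card_univ]

end Zd

end Literature.Probability.LatticeModels

end
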